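import Literature.Barriers.NavierStokesRegularity.BuckmasterVicolNonuniquenessIteration
import Literature.Barriers.AnomalousDissipation.ConvexIntegrationNonLerayIteration
import Literature.Analysis.FluidPDE.BVEnergyStage
import HarnessLib

/-!
# Buckmaster–Vicol 2019, Prop. 2.1 (the main iteration with energy profile): the discharge

Sibling proof file of `Literature/Barriers/NavierStokesRegularity/BuckmasterVicolNonuniquenessIteration`:
`BuckmasterVicol2019_prop21_holds` proves the named fact `BuckmasterVicol2019_prop21` (Prop. 2.1 of
Buckmaster–Vicol, Ann. of Math. 189 (2019), with the inductive estimates (2.2)–(2.6) and the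
increment bound (2.7)) from the stage theorem `Literature.Analysis.FluidPDE.EnergyPump.stage`
(files `Analysis/FluidPDE/BVEnergyStage*`, `EnergyPumpTools`, `NSRTimeGluing`,
`MollifiedNSRTripleLocal`, `JetStepWeighted*`), i.e. from the intermittent-jet form of the scheme
([BV 2020, §7]: mollification, time cut-off of the energy gap and gluing, energy pump
`ρ(t) ∼ e(t) - ∫|v_q|² - δ_{q+2}/2` realised by a smooth weight on the jets, the weighted jet step with
its two-sided energy identity, and a final re-mollification/gluing for the `C¹` bound (2.4) of the
new stress), with the parameters `b = 80000`, `β = 1/(4000 b²)`, `ε_R = 1/1000`, `N_Λ = 1`, jet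
frequency `λ_{q+1}^{1/2} = λ_q^{40000}` and slack `ω = λ_q^{10}`; `a₀` depends on `T`, on the `C²`
size of `e` on `[0,T]` and on the absolute constants.

## References

* T. Buckmaster, V. Vicol, *Nonuniqueness of weak solutions to the Navier–Stokes equation*,
  Ann. of Math. 189 (2019) = arXiv:1709.10033, Prop. 2.1, §2.1–§2.3, §§4–7. [`BuckmasterVicol2019AnnMath`]
* T. Buckmaster, V. Vicol, *Convex integration and phenomenologies in turbulence*, EMS Surv.
  Math. Sci. 6 (2019) = arXiv:1901.09023, Thm. 7.1, §7. [`BuckmasterVicol2020`]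
-/

noncomputable section

open MeasureTheory Set Filter Function
open scoped ENNReal NNReal InnerProductSpace Topology ContDiff

namespace Literature.Barriers.NavierStokesRegularity

open Literature.Analysis.FunctionSpaces Literature.Analysis.FluidPDE
open Literature.Barriers.AnomalousDissipation Literature.Barriers.AnomalousDissipation.BV2019



open EnergyPump

set_option maxHeartbeats 4000000 in
/-- **Buckmaster–Vicol 2019, Prop. 2.1** (the main iterative proposition, with the energy profile
`e` and the inductive estimates (2.2)–(2.7)), proved: `BuckmasterVicol2019_prop21` holds, with
`b = 80000`, `β = 1/(4000 b²)`, `ε_R = 1/1000`, `N_Λ = 1`.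
[cite: BuckmasterVicol2019AnnMath, Prop. 2.1, §2.3 p. 5, §§4–7; BuckmasterVicol2020, Thm. 7.1, §7] -/
theorem BuckmasterVicol2019_prop21_holds : BuckmasterVicol2019_prop21 := by
  obtain ⟨C₀, hC₀, M₀, hM₀, hstage⟩ := EnergyPump.stage
  -- two elementary facts on real powers (`(yⁿ)ʳ = y^{nr}`; `cᵏ ≤ y ⇒ c ≤ y^{1/k}`)
  have npow_rpow : ∀ {y : ℝ}, 0 ≤ y → ∀ (n : ℕ) (r : ℝ), (y ^ n) ^ r = y ^ ((n : ℝ) * r) := fun hy n r => by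
    rw [← Real.rpow_natCast, ← Real.rpow_mul hy]
  have le_rpow_inv_of_pow_le : ∀ {c y : ℝ}, 0 ≤ c → ∀ {k : ℕ}, k ≠ 0 → c ^ k ≤ y → c ≤ y ^ ((k : ℝ)⁻¹) := by
    intro c y hc k hk h
    have e1 : c = (c ^ k) ^ ((k : ℝ)⁻¹) := (Real.pow_rpow_inv_natCast hc hk).symm
    rw [e1]; exact Real.rpow_le_rpow (by positivity) h (by positivity)
  refine ⟨80000, ⟨5000, by norm_num⟩, by norm_num, 1 / (4000 * (80000 : ℝ) ^ 2), by positivity, by norm_num, by norm_num,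
    M₀, hM₀, 1 / 1000, by norm_num, 1, one_pos, ?_⟩
  intro ν hν hν1 T hT e he _he0
  obtain ⟨ω₀, hω₀, hst⟩ := hstage T hT
  -- `C²` bounds of the energy profile on `[0,T]`
  have he' := EnergyPump.contDiffOn_derivWithin hT he
  have he'' := EnergyPump.contDiffOn_derivWithin hT he'
  obtain ⟨E₁, hE₁⟩ := isCompact_Icc.exists_bound_of_continuousOn he'.continuousOn
  obtain ⟨E₂, hE₂⟩ := isCompact_Icc.exists_bound_of_continuousOn he''.continuousOn
  have hE₁' : ∀ t ∈ Icc 0 T, |derivWithin e (Icc 0 T) t| ≤ |E₁| := fun t ht => by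
    have := hE₁ t ht; rw [Real.norm_eq_abs] at this; exact this.trans (le_abs_self _)
  have hE₂' : ∀ t ∈ Icc 0 T, |derivWithin (derivWithin e (Icc 0 T)) (Icc 0 T) t| ≤ |E₂| := fun t ht => by
    have := hE₂ t ht; rw [Real.norm_eq_abs] at this; exact this.trans (le_abs_self _)
  -- the threshold on `a`
  have hC₀0 : 0 ≤ C₀ := by linarith
  have hC₀pow : C₀ ≤ C₀ ^ 2000 := by
    calc C₀ = C₀ ^ 1 := (pow_one C₀).symm
      _ ≤ C₀ ^ 2000 := pow_le_pow_right₀ hC₀ (by norm_num)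
  obtain ⟨K30, hK30⟩ : ∃ K : ℝ, K = (30 : ℝ) ^ 20 := ⟨_, rfl⟩
  obtain ⟨KC, hKC⟩ : ∃ K : ℝ, K = C₀ ^ 2000 := ⟨_, rfl⟩
  have h30 : 0 ≤ K30 := by rw [hK30]; positivity
  have hCp0 : 0 ≤ KC := by rw [hKC]; positivity
  set Abig : ℝ := ω₀ + |E₁| + |E₂| + KC + K30 + 2 with hAbig
  obtain ⟨a₁, ha₁⟩ := exists_nat_ge Abig
  refine ⟨max a₁ (10 ^ 8000), fun a ha _ q v p R hns hmean hvC1 hRL1 hRC1 hgap hR0 => ?_⟩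
  have haR : Abig ≤ a := ha₁.trans (by exact_mod_cast le_of_max_le_left ha)
  have ha8000R : (10 : ℝ) ^ 8000 ≤ a := by exact_mod_cast le_of_max_le_right ha
  have hA1 := abs_nonneg E₁
  have hA2 := abs_nonneg E₂
  have hAbig' : ω₀ + |E₁| + |E₂| + KC + K30 + 2 ≤ a := by simpa only [hAbig] using haR
  have ha1R : (1 : ℝ) ≤ a := by linarith only [hAbig', hω₀, hA1, hA2, h30, hCp0]
  have ha1 : 1 ≤ a := by exact_mod_cast ha1R
  -- ### the level sizes, all powers of `x = λ_q`
  set x : ℝ := (freq a 80000 q : ℝ) with hxdef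
  have hx1 : 1 ≤ x := one_le_freq_real ha1 _ _
  have hx0 : 0 ≤ x := by linarith
  have hxpos : 0 < x := by linarith
  have hxa : (a : ℝ) ≤ x := by
    have : (a : ℝ) ^ 1 ≤ (a : ℝ) ^ 80000 ^ q := pow_le_pow_right₀ ha1R (Nat.one_le_pow _ _ (by norm_num))
    rw [pow_one] at this; rw [hxdef, freq_eq]; push_cast; exact this
  have hΛ : (freq a 80000 (q + 1) : ℝ) = x ^ 80000 := freq_succ_real a 80000 q
  have hΛ2 : (freq a 80000 (q + 2) : ℝ) = (x ^ 80000) ^ 80000 := by rw [freq_succ_real, hΛ]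
  set lam1 : ℝ := (freq a 80000 1 : ℝ) with hlam1
  have hlam1_1 : 1 ≤ lam1 := one_le_freq_real ha1 _ _
  have hlam1_le : lam1 ≤ x ^ 80000 := by
    have e1 : lam1 = (a : ℝ) ^ 80000 := by rw [hlam1, freq_eq]; push_cast; ring
    rw [e1]; exact pow_le_pow_left₀ (by positivity) hxa 80000
  set β : ℝ := 1 / (4000 * (80000 : ℝ) ^ 2) with hβ
  have hβ0 : 0 ≤ β := by positivity
  set P₁ : ℝ := lam1 ^ (3 * β) with hP₁
  have hP₁1 : 1 ≤ P₁ := Real.one_le_rpow hlam1_1 (by positivity)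
  have hP₁0 : 0 ≤ P₁ := by linarith
  have hP₁le : P₁ ≤ x ^ (3 / 320000000 : ℝ) := by
    calc P₁ ≤ (x ^ 80000) ^ (3 * β) := Real.rpow_le_rpow (by linarith) hlam1_le (by positivity)
      _ = x ^ (3 / 320000000 : ℝ) := by rw [npow_rpow hx0]; norm_num [hβ]
  set Δ : ℝ := amp β a 80000 (q + 1) with hΔdef
  set δ : ℝ := amp β a 80000 (q + 2) with hδdef
  have hΔeq : Δ = P₁ * x ^ (-(1 / 160000000 : ℝ)) := by
    rw [hΔdef, amp, hΛ, npow_rpow hx0]; norm_num [hβ, hP₁, hlam1]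
  have hδeq : δ = P₁ * x ^ (-(1 / 2000 : ℝ)) := by
    rw [hδdef, amp, hΛ2, ← pow_mul, npow_rpow hx0]; norm_num [hβ, hP₁, hlam1]
  have hΔpos : 0 < Δ := amp_pos β ha1 _ _
  have hδpos : 0 < δ := amp_pos β ha1 _ _
  -- monotonicity of powers of `x`
  have xle : ∀ {r s : ℝ}, r ≤ s → x ^ r ≤ x ^ s := fun h => Real.rpow_le_rpow_of_exponent_le hx1 h
  have xle1 : ∀ {s : ℝ}, s ≤ 0 → x ^ s ≤ 1 := fun h => Real.rpow_le_one_of_one_le_of_nonpos hx1 h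
  have xnn : ∀ r : ℝ, 0 ≤ x ^ r := fun r => Real.rpow_nonneg hx0 r
  -- the three thresholds: `100 ≤ x^{1/4000}`, `C₀ ≤ x^{1/2000}`, `30 ≤ x^{1/20}`
  have hT1 : (100 : ℝ) ≤ x ^ (1 / 4000 : ℝ) := by
    have h1 : (100 : ℝ) ^ 4000 ≤ x := by
      rw [show (100 : ℝ) ^ 4000 = 10 ^ 8000 by rw [show (100 : ℝ) = 10 ^ 2 by norm_num, ← pow_mul]]; exact ha8000R.trans hxa
    have := le_rpow_inv_of_pow_le (by norm_num) (by norm_num) h1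
    rwa [show ((4000 : ℕ) : ℝ)⁻¹ = (1 / 4000 : ℝ) by norm_num] at this
  have hT2 : C₀ ≤ x ^ (1 / 2000 : ℝ) := by
    have h1 : C₀ ^ 2000 ≤ x := by rw [← hKC]; linarith only [hAbig', hω₀, hA1, hA2, h30, hCp0, hxa]
    have := le_rpow_inv_of_pow_le hC₀0 (by norm_num) h1
    rwa [show ((2000 : ℕ) : ℝ)⁻¹ = (1 / 2000 : ℝ) by norm_num] at this
  have hT3 : (30 : ℝ) ≤ x ^ (1 / 20 : ℝ) := by
    have h1 : (30 : ℝ) ^ 20 ≤ x := by rw [← hK30]; linarith only [hAbig', hω₀, hA1, hA2, h30, hCp0, hxa]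
    have := le_rpow_inv_of_pow_le (by norm_num) (by norm_num) h1
    rwa [show ((20 : ℕ) : ℝ)⁻¹ = (1 / 20 : ℝ) by norm_num] at this
  -- ### the hypotheses of the stage theorem
  set L : ℝ := x ^ 40000 with hLdef
  set om : ℝ := x ^ 10 with homdef
  have hL1 : 1 ≤ L := one_le_pow₀ hx1
  have hxom : x ≤ om := by
    calc x = x ^ 1 := (pow_one x).symm
      _ ≤ x ^ 10 := pow_le_pow_right₀ hx1 (by norm_num)
  have hom_rpow : om = x ^ (10 : ℝ) := by rw [homdef]; exact_mod_cast (Real.rpow_natCast x 10).symm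
  have hE₁ω : |E₁| ≤ om := le_trans (by linarith only [hAbig', hω₀, hA1, hA2, h30, hCp0, hxa]) hxom
  have hE₂ω : |E₂| ≤ om := le_trans (by linarith only [hAbig', hω₀, hA1, hA2, h30, hCp0, hxa]) hxom
  have hω₀ω : ω₀ ≤ om := le_trans (by linarith only [hAbig', hω₀, hA1, hA2, h30, hCp0, hxa]) hxom
  have hVω : x ^ 4 ≤ om := pow_le_pow_right₀ hx1 (by norm_num)
  have hV1 : 1 ≤ x ^ 4 := one_le_pow₀ hx1
  have hA1' : 1 ≤ x ^ 10 := one_le_pow₀ hx1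
  have hΔω : Δ ≤ om := by
    rw [hΔeq, hom_rpow]
    calc P₁ * x ^ (-(1 / 160000000 : ℝ)) ≤ x ^ (3 / 320000000 : ℝ) * 1 := mul_le_mul hP₁le (xle1 (by norm_num)) (xnn _) (xnn _)
      _ ≤ x ^ (10 : ℝ) := by rw [mul_one]; exact xle (by norm_num)
  have hΔiω : Δ⁻¹ ≤ om := by
    rw [hΔeq, mul_inv, ← Real.rpow_neg hx0, neg_neg, hom_rpow]
    calc P₁⁻¹ * x ^ (1 / 160000000 : ℝ) ≤ 1 * x ^ (10 : ℝ) := mul_le_mul (inv_le_one_of_one_le₀ hP₁1) (xle (by norm_num)) (xnn _) zero_le_one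
      _ = x ^ (10 : ℝ) := one_mul _
  have hδiω : δ⁻¹ ≤ om := by
    rw [hδeq, mul_inv, ← Real.rpow_neg hx0, neg_neg, hom_rpow]
    calc P₁⁻¹ * x ^ (1 / 2000 : ℝ) ≤ 1 * x ^ (10 : ℝ) := mul_le_mul (inv_le_one_of_one_le₀ hP₁1) (xle (by norm_num)) (xnn _) zero_le_one
      _ = x ^ (10 : ℝ) := one_mul _
  have hδΔ : δ ≤ Δ / 100 := by
    rw [hΔeq, hδeq, le_div_iff₀ (by norm_num : (0:ℝ) < 100)]
    have h1 : x ^ (-(1 / 2000 : ℝ)) * 100 ≤ x ^ (-(1 / 160000000 : ℝ)) := by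
      have h2 : x ^ (-(1 / 2000 : ℝ)) * x ^ (1 / 4000 : ℝ) ≤ x ^ (-(1 / 160000000 : ℝ)) := by
        rw [← Real.rpow_add hxpos]; exact xle (by norm_num)
      exact le_trans (mul_le_mul_of_nonneg_left hT1 (xnn _)) h2
    calc P₁ * x ^ (-(1 / 2000 : ℝ)) * 100 = P₁ * (x ^ (-(1 / 2000 : ℝ)) * 100) := by ring
      _ ≤ P₁ * x ^ (-(1 / 160000000 : ℝ)) := mul_le_mul_of_nonneg_left h1 hP₁0
  set δR : ℝ := x ^ (-(1 / 1000 : ℝ)) * Δ with hδR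
  have hδRpos : 0 < δR := mul_pos (Real.rpow_pos_of_pos hxpos _) hΔpos
  have hC₀δ : C₀ * δR ≤ δ := by
    rw [hδR, hΔeq, hδeq]
    have h1 : C₀ * x ^ (-(1 / 1000 : ℝ)) * x ^ (-(1 / 160000000 : ℝ)) ≤ x ^ (-(1 / 2000 : ℝ)) := by
      calc C₀ * x ^ (-(1 / 1000 : ℝ)) * x ^ (-(1 / 160000000 : ℝ))
          ≤ x ^ (1 / 2000 : ℝ) * x ^ (-(1 / 1000 : ℝ)) * x ^ (-(1 / 160000000 : ℝ)) := by gcongr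
        _ = x ^ ((1 / 2000 : ℝ) + -(1 / 1000) + -(1 / 160000000)) := by rw [Real.rpow_add hxpos, Real.rpow_add hxpos]
        _ ≤ x ^ (-(1 / 2000 : ℝ)) := xle (by norm_num)
    calc C₀ * (x ^ (-(1 / 1000 : ℝ)) * (P₁ * x ^ (-(1 / 160000000 : ℝ)))) = P₁ * (C₀ * x ^ (-(1 / 1000 : ℝ)) * x ^ (-(1 / 160000000 : ℝ))) := by ring
      _ ≤ P₁ * x ^ (-(1 / 2000 : ℝ)) := mul_le_mul_of_nonneg_left h1 hP₁0
  have hB0 : JetStep.B0 = 20000 := rfl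
  have hlamB : L ^ (1 / JetStep.B0) = x ^ 2 := by
    rw [hB0, hLdef, npow_rpow hx0, show ((40000 : ℕ) : ℝ) * (1 / 20000) = ((2 : ℕ) : ℝ) by norm_num, Real.rpow_natCast]
  have hC₀x : C₀ ≤ x := hC₀pow.trans (by rw [← hKC]; linarith only [hAbig', hω₀, hA1, hA2, h30, hCp0, hxa])
  have hx4 : x ≤ x ^ 4 := by
    calc x = x ^ 1 := (pow_one x).symm
      _ ≤ x ^ 4 := pow_le_pow_right₀ hx1 (by norm_num)
  have hx10 : x ≤ x ^ 10 := hxom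
  have hC₀V : C₀ * x ^ 4 ≤ (L ^ (1 / JetStep.B0)) ^ 4 := by
    rw [hlamB, ← pow_mul, show 2 * 4 = 4 + 4 by norm_num, pow_add]
    exact mul_le_mul_of_nonneg_right (hC₀x.trans hx4) (by positivity)
  have hC₀A : C₀ * x ^ 10 ≤ (L ^ (1 / JetStep.B0)) ^ 10 := by
    rw [hlamB, ← pow_mul, show 2 * 10 = 10 + 10 by norm_num, pow_add]
    exact mul_le_mul_of_nonneg_right (hC₀x.trans hx10) (by positivity)
  have hL20 : L ^ (1 / (20 * JetStep.B0)) = x ^ (1 / 10 : ℝ) := by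
    rw [hB0, hLdef, npow_rpow hx0]; norm_num
  have hγ1 : Δ / 30 ≤ L ^ (1 / (20 * JetStep.B0)) := by
    rw [hL20]
    have h1 : Δ ≤ x ^ (1 / 10 : ℝ) := by
      rw [hΔeq]
      calc P₁ * x ^ (-(1 / 160000000 : ℝ)) ≤ x ^ (3 / 320000000 : ℝ) * 1 := mul_le_mul hP₁le (xle1 (by norm_num)) (xnn _) (xnn _)
        _ ≤ x ^ (1 / 10 : ℝ) := by rw [mul_one]; exact xle (by norm_num)
    have h2 : Δ / 30 ≤ Δ := div_le_self hΔpos.le (by norm_num)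
    exact h2.trans h1
  have hγlow : L ^ (-(1 / (20 * JetStep.B0))) ≤ Δ / 30 := by
    have e1 : L ^ (-(1 / (20 * JetStep.B0))) = x ^ (-(1 / 10 : ℝ)) := by rw [hB0, hLdef, npow_rpow hx0]; norm_num
    rw [e1, hΔeq, le_div_iff₀ (by norm_num : (0:ℝ) < 30)]
    have h1 : x ^ (-(1 / 10 : ℝ)) * 30 ≤ x ^ (-(1 / 160000000 : ℝ)) := by
      calc x ^ (-(1 / 10 : ℝ)) * 30 ≤ x ^ (-(1 / 10 : ℝ)) * x ^ (1 / 20 : ℝ) := mul_le_mul_of_nonneg_left hT3 (xnn _)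
        _ = x ^ (-(1 / 10 : ℝ) + 1 / 20) := by rw [Real.rpow_add hxpos]
        _ ≤ x ^ (-(1 / 160000000 : ℝ)) := xle (by norm_num)
    calc x ^ (-(1 / 10 : ℝ)) * 30 ≤ 1 * x ^ (-(1 / 160000000 : ℝ)) := by rw [one_mul]; exact h1
      _ ≤ P₁ * x ^ (-(1 / 160000000 : ℝ)) := mul_le_mul_of_nonneg_right hP₁1 (xnn _)
  have hM : om ^ 4000 ≤ L := by rw [homdef, hLdef, ← pow_mul]
  have hσN : (((freq a 80000 q) ^ 7500 : ℕ) : ℝ) = L ^ (3 / 16 : ℝ) := by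
    rw [hLdef, npow_rpow hx0, show ((40000 : ℕ) : ℝ) * (3 / 16) = ((7500 : ℕ) : ℝ) by norm_num, Real.rpow_natCast]; push_cast; rw [hxdef]
  -- the level-`q` data
  have h00 : (0 : ℝ) ∈ Icc 0 T := ⟨le_rfl, hT.le⟩
  obtain ⟨B₀, B₂, B₁, hB₀, hB₁, hB₂, hBsum⟩ := hvC1
  have hB₀0 : 0 ≤ B₀ := (norm_nonneg _).trans (hB₀ 0 h00 0)
  have hB₁0 : ∀ i, 0 ≤ B₁ i := fun i => (norm_nonneg _).trans (hB₁ i 0 h00 0)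
  have hB₂0 : 0 ≤ B₂ := (norm_nonneg _).trans (hB₂ 0 h00 0)
  have hB₁s : 0 ≤ ∑ i, B₁ i := Finset.sum_nonneg fun i _ => hB₁0 i
  have hB₁le : ∀ i, B₁ i ≤ ∑ j, B₁ j := fun i => Finset.single_le_sum (fun j _ => hB₁0 j) (Finset.mem_univ i)
  have hv0 : ∀ t ∈ Icc 0 T, ∀ y, ‖v t y‖ ≤ x ^ 4 := fun t ht y => (hB₀ t ht y).trans (by linarith)
  have hv1 : ∀ i, ∀ t ∈ Icc 0 T, ∀ y, ‖Torus.partialDeriv i (v t) y‖ ≤ x ^ 4 := fun i t ht y => (hB₁ i t ht y).trans (by linarith [hB₁le i])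
  have hvt : ∀ t ∈ Icc 0 T, ∀ y, ‖Torus.timeDerivWithin (Icc 0 T) v t y‖ ≤ x ^ 4 := fun t ht y => (hB₂ t ht y).trans (by linarith)
  obtain ⟨A₀, A₂, A₁, hA₀, hA₁', hA₂, hAsum⟩ := hRC1
  have hA₁0 : ∀ i, 0 ≤ A₁ i := fun i => (norm_nonneg _).trans (hA₁' i 0 h00 0)
  have hA₂0 : 0 ≤ A₂ := (norm_nonneg _).trans (hA₂ 0 h00 0)
  have hA₁s : 0 ≤ ∑ i, A₁ i := Finset.sum_nonneg fun i _ => hA₁0 i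
  have hRA : ∀ t ∈ Icc 0 T, ∀ y, ‖R t y‖ ≤ x ^ 10 := fun t ht y => (hA₀ t ht y).trans (by linarith)
  have hRδ : ∀ t ∈ Icc 0 T, ∫ y, ‖R t y‖ ≤ δR := hRL1
  -- ### the stage
  obtain ⟨vn, pn, Rn, hnsn, hmeann, hvn0, hvn1, hvnt, hRnL1, hRn0, hRn1, hRnt, hgapn, h26n, hL2n⟩ :=
    hst ν e |E₁| |E₂| v p R (x ^ 4) (x ^ 10) δR Δ δ L om ((freq a 80000 q) ^ 7500) hν hν1 he hE₁' hE₂' hE₁ω hE₂ω hω₀ω hns hmean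
      hV1 hVω hv0 hv1 hvt hA1' le_rfl hRA hδRpos hRδ hδpos hδΔ hΔpos hΔω hΔiω hδiω hgap hR0 hL1 hM hσN hC₀δ hC₀V hC₀A hγ1 hγlow
  -- ### translation to the level `q+1`
  have hL8 : L ^ (8 : ℝ) = (freq a 80000 (q + 1) : ℝ) ^ 4 := by
    rw [hΛ, hLdef, show (8 : ℝ) = ((8 : ℕ) : ℝ) by norm_num, Real.rpow_natCast, ← pow_mul, ← pow_mul]
  have hL20' : L ^ (20 : ℝ) = (freq a 80000 (q + 1) : ℝ) ^ 10 := by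
    rw [hΛ, hLdef, show (20 : ℝ) = ((20 : ℕ) : ℝ) by norm_num, Real.rpow_natCast, ← pow_mul, ← pow_mul]
  have hL500 : L ^ (-(1 / 500 : ℝ)) = (freq a 80000 (q + 1) : ℝ) ^ (-(1 / 1000 : ℝ)) := by
    rw [hΛ, hLdef, npow_rpow hx0, npow_rpow hx0]; norm_num
  have hsqrtΔ : Real.sqrt Δ = amp β a 80000 (q + 1) ^ (1 / 2 : ℝ) := by rw [Real.sqrt_eq_rpow]
  refine ⟨vn, pn, Rn, hnsn, hmeann, ?_, ?_, ?_, hgapn, h26n, fun t ht => by rw [← hsqrtΔ]; exact hL2n t ht⟩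
  · refine ⟨(freq a 80000 (q + 1) : ℝ) ^ 4 / 5, (freq a 80000 (q + 1) : ℝ) ^ 4 / 5, fun _ => (freq a 80000 (q + 1) : ℝ) ^ 4 / 5,
      fun t ht y => by rw [← hL8]; exact hvn0 t ht y, fun i t ht y => by rw [← hL8]; exact hvn1 i t ht y,
      fun t ht y => by rw [← hL8]; exact hvnt t ht y, ?_⟩
    simp only [Finset.sum_const, Finset.card_univ, Fintype.card_fin, nsmul_eq_mul]; push_cast; linarith
  · intro t ht
    have := hRnL1 t ht
    rwa [hL500] at this
  · refine ⟨(freq a 80000 (q + 1) : ℝ) ^ 10 / 5, (freq a 80000 (q + 1) : ℝ) ^ 10 / 5, fun _ => (freq a 80000 (q + 1) : ℝ) ^ 10 / 5,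
      fun t ht y => by rw [← hL20']; exact hRn0 t ht y, fun i t ht y => by rw [← hL20']; exact hRn1 i t ht y,
      fun t ht y => by rw [← hL20']; exact hRnt t ht y, ?_⟩
    simp only [Finset.sum_const, Finset.card_univ, Fintype.card_fin, nsmul_eq_mul]; push_cast; linarith

/-- **Buckmaster–Vicol 2019, Thm. 1.2 as printed** (`ν ∈ (0,1]`, smooth nonnegative energy profile
prescribed on `[0,T]`, weak solution in `C⁰_t H^β_x` of zero mean), proved: the named fact
`BuckmasterVicol2019_thm12` follows from Prop. 2.1 (`BuckmasterVicol2019_prop21_holds`) by the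
proved §2.4 (`BuckmasterVicol2019_thm12_of_prop21`).
[cite: BuckmasterVicol2019AnnMath, Thm. 1.2 and §2.4] -/
theorem BuckmasterVicol2019_thm12_holds : BuckmasterVicol2019_thm12 :=
  BuckmasterVicol2019_thm12_of_prop21 BuckmasterVicol2019_prop21_holds

/-- **The catalogued barrier `BuckmasterVicolNonuniqueness` holds unconditionally** (non-uniqueness
of finite-energy weak solutions of Navier–Stokes on `𝕋³`, Buckmaster–Vicol 2019, Thm. 1.2, in the
tree's `ν`-general rendering): from Prop. 2.1 (`BuckmasterVicol2019_prop21_holds`) through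
`BuckmasterVicolNonuniqueness_of_prop21` (§2.4 and the time-rescaling step). Its trust base is now
empty. [cite: BuckmasterVicol2019AnnMath, Thm. 1.2, Prop. 2.1 and §2.4] -/
theorem BuckmasterVicolNonuniqueness_holds : BuckmasterVicolNonuniqueness :=
  BuckmasterVicolNonuniqueness_of_prop21 BuckmasterVicol2019_prop21_holds

end Literature.Barriers.NavierStokesRegularity
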